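import Summits.BirchSwinnertonDyer.BirchSwinnertonDyer.Theorems.Rank2Observatory2DescKillCheck

/-!
# BirchSwinnertonDyer — rank ≥ 2 observatory: KERNEL-2DESC kill layer (QK), the one-digit residue
# tree deciding that a binary quartic is never a square on `p`-primitive pairs, integers only

HONEST FRAMING: per-curve certified theorems and census instruments; no claim on BSD in rank ≥ 2.

Generic file of the KERNEL-2DESC-CL "QK" kill layer (cert-1 gen 26; design note
`code/b2b-bsdr2-cert-1/kernel-2desc-cl/v2/HANDOFF-g26.md`). The 2-covering of a class `z` of the
cubic-field 2-descent is the intersection of the two quadrics `killQ = (Q₁, Q₂) = 0` in `ℙ³`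
(`Rank2Observatory2DescKillCheck`). Once the singular member of the pencil (the conic
`c₁Q₁ + c₂Q₂`, `c₁t₁ + c₂t₂ = 0`, which does not involve `n`) has a rational point, the covering is
the double cover `m² = G(u, v)` of `ℙ¹` by a binary quartic `G` (`Rank2Observatory2DescKillConic`
constructs `G` and proves that every `p`-primitive integer zero of `killQ` yields `p`-primitive
`(u, v)` and `m` with `G(u, v) = m²`). This file is the INTEGER half for the quartic:

* `quartEval` — the value `Σ gᵢ uⁱ v⁴⁻ⁱ` of a quartic given by its five coefficients (Horner form);
* `pval`, `sqResidue`, `qdead` — a node of the tree knows `G ≡ N (mod p^k)`; it is DEAD when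
  `e = min(v_p(N), k) < k` and either `e` is odd, or `p` is odd and `N/p^e` is a non-residue mod `p`,
  or `p = 2` and `N/2^e ≢ 1 (mod 4)` (resp. `mod 8`) with two (resp. three) spare digits;
* `qnode`, `qkCheck` — the fuelled search: chart A (`v` scaled to `1`, `u ≡ w`), chart B (`u`
  scaled to `1`, `v ≡ w ≡ 0 (mod p)`); a live node is split into its `p` children `w + p^k d`;
  ONE free digit per level (the plain tree of `killCheck` has three), evaluated by `decide`;
* `qkCheck_sound` — if `qkCheck p g fuel = true` for a prime `p` then `G(u, v) ≠ m²` for all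
  integers `u, v, m` with `¬ (p ∣ u ∧ p ∣ v)`.

Elementary throughout (congruences pushed through `ZMod (p^k)`, parity of the exponent of `p` in a
square, squares mod `p` and mod `8`); no `p`-adic numbers. References: J. E. Cremona, *Algorithms
for Modular Elliptic Curves* (1997), §3.6 (local solubility of `y² = g(x)` by residue recursion);
B. J. Birch and H. P. F. Swinnerton-Dyer, Notes on elliptic curves. I, J. reine angew. Math. 212
(1963) 7–25, §§2–3 (the quartic model and its `p`-adic solubility test).
[cite: CremonaAlgorithms1997, §3.6]
-/

set_option linter.dupNamespace false

namespace Summit.BirchSwinnertonDyer.BirchSwinnertonDyer.Rank2Observatory.TwoDescKill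

/-! ### Binary quartics by coefficients -/

section Ring

variable {R : Type*} [CommRing R]

/-- `G(u, v) = g₀v⁴ + g₁uv³ + g₂u²v² + g₃u³v + g₄u⁴` for `g = (g₀, g₁, g₂, g₃, g₄)`, Horner form. [folklore] -/
def quartEval (g : R × R × R × R × R) (u v : R) : R :=
  (((g.2.2.2.2 * u + g.2.2.2.1 * v) * u + g.2.2.1 * v * v) * u + g.2.1 * v ^ 3) * u + g.1 * v ^ 4

/-- `quartEval` commutes with ring maps. [folklore] -/
theorem map_quartEval {S : Type*} [CommRing S] (f : R →+* S) (g : R × R × R × R × R) (u v : R) :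
    f (quartEval g u v) = quartEval (f g.1, f g.2.1, f g.2.2.1, f g.2.2.2.1, f g.2.2.2.2) (f u) (f v) := by
  simp only [quartEval, map_add, map_mul, map_pow]

/-- `quartEval` is homogeneous of degree `4`. [folklore] -/
theorem quartEval_smul (g : R × R × R × R × R) (l u v : R) :
    quartEval g (l * u) (l * v) = l ^ 4 * quartEval g u v := by
  simp only [quartEval]; ring

/-- The monomial form of `quartEval`. [folklore] -/
theorem quartEval_eq (g : R × R × R × R × R) (u v : R) :
    quartEval g u v = g.1 * v ^ 4 + g.2.1 * u * v ^ 3 + g.2.2.1 * u ^ 2 * v ^ 2 +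
      g.2.2.2.1 * u ^ 3 * v + g.2.2.2.2 * u ^ 4 := by
  simp only [quartEval]; ring

end Ring

/-! ### The one-digit residue tree -/

/-- `pval p k n = (e, n / p^e)` with `e = min(v_p(n), k)` (`n = 0 ↦ (k, 0)`). [folklore] -/
def pval (p : ℕ) : ℕ → ℤ → ℕ × ℤ
  | 0, n => (0, n)
  | k + 1, n => if n % (p : ℤ) = 0 then ((pval p k (n / (p : ℤ))).1 + 1, (pval p k (n / (p : ℤ))).2)
      else (0, n)

/-- `g` is a square modulo `p` (search over the residues `0 … p-1`). [folklore] -/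
def sqResidue (p : ℕ) (g : ℤ) : Bool :=
  (List.range p).any fun x => decide ((((x : ℕ) : ℤ) * x - g) % (p : ℤ) = 0)

/-- A node knowing `G ≡ N (mod p^k)` is DEAD: no integer `≡ N (mod p^k)` is a square. [folklore] -/
def qdead (p : ℕ) (N : ℤ) (k : ℕ) : Bool :=
  decide ((pval p k N).1 < k) &&
    (decide ((pval p k N).1 % 2 = 1) ||
      if p = 2 then
        (decide ((pval p k N).1 + 2 ≤ k) && decide ((pval p k N).2 % 4 = 3)) ||
          (decide ((pval p k N).1 + 3 ≤ k) && decide ((pval p k N).2 % 8 = 5))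
      else !sqResidue p (pval p k N).2)

/-- Node value: chart A is `(u, v) ≡ (w, 1)`, chart B is `(u, v) ≡ (1, w)`. [folklore] -/
def qval (g : ℤ × ℤ × ℤ × ℤ × ℤ) (A : Bool) (w : ℤ) : ℤ :=
  if A then quartEval g w 1 else quartEval g 1 w

/-- The fuelled search below the node `(w, k)` of chart `A`: dead, or all `p` children certified.
[cite: CremonaAlgorithms1997, §3.6] -/
def qnode (p : ℕ) (g : ℤ × ℤ × ℤ × ℤ × ℤ) (A : Bool) : ℕ → ℤ → ℕ → Bool
  | 0, w, k => qdead p (qval g A w) k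
  | f + 1, w, k => qdead p (qval g A w) k ||
      (List.range p).all fun d => qnode p g A f (w + (p : ℤ) ^ k * (d : ℤ)) (k + 1)

/-- **The QK certificate**: every chart-normalised residue pair mod `p` is certified by `qnode`.
[cite: CremonaAlgorithms1997, §3.6] -/
def qkCheck (p : ℕ) (g : ℤ × ℤ × ℤ × ℤ × ℤ) (fuel : ℕ) : Bool :=
  ((List.range p).all fun d => qnode p g true fuel (d : ℤ) 1) && qnode p g false fuel 0 1

/-! ### Soundness -/

/-- Specification of `pval`. [folklore] -/
theorem pval_spec (p : ℕ) : ∀ (k : ℕ) (n : ℤ),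
    (pval p k n).1 ≤ k ∧ n = (p : ℤ) ^ (pval p k n).1 * (pval p k n).2 ∧
      ((pval p k n).1 < k → ¬ (p : ℤ) ∣ (pval p k n).2)
  | 0, n => by simp [pval]
  | k + 1, n => by
      by_cases h : n % (p : ℤ) = 0
      · obtain ⟨h1, h2, h3⟩ := pval_spec p k (n / (p : ℤ))
        simp only [pval, h, ↓reduceIte]
        refine ⟨by omega, ?_, fun hlt => h3 (by omega)⟩
        have hn : n = (p : ℤ) * (n / (p : ℤ)) := (Int.mul_ediv_cancel' (Int.dvd_of_emod_eq_zero h)).symm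
        calc n = (p : ℤ) * (n / (p : ℤ)) := hn
          _ = (p : ℤ) * ((p : ℤ) ^ (pval p k (n / (p : ℤ))).1 * (pval p k (n / (p : ℤ))).2) := by rw [← h2]
          _ = _ := by ring
      · simp only [pval, h, ↓reduceIte]
        exact ⟨by omega, by simp, fun _ hd => h (Int.emod_eq_zero_of_dvd hd)⟩

/-- A square root mod `p` makes `sqResidue` true. [folklore] -/
theorem sqResidue_of_sq {p : ℕ} (hp : 0 < p) {g m : ℤ} (h : (p : ℤ) ∣ m * m - g) :
    sqResidue p g = true := by
  simp only [sqResidue, List.any_eq_true, List.mem_range, decide_eq_true_eq]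
  have hp' : (0 : ℤ) < p := by exact_mod_cast hp
  refine ⟨(m % (p : ℤ)).toNat, ?_, ?_⟩
  · have := Int.emod_lt_of_pos m hp'; have := Int.emod_nonneg m hp'.ne'; omega
  · rw [Int.toNat_of_nonneg (Int.emod_nonneg m hp'.ne')]
    apply Int.emod_eq_zero_of_dvd
    have e : (p : ℤ) ∣ m % (p : ℤ) - m :=
      ⟨-(m / (p : ℤ)), by linear_combination Int.emod_add_ediv_mul m (p : ℤ)⟩
    have : m % (p : ℤ) * (m % (p : ℤ)) - g = (m % (p : ℤ) - m) * (m % (p : ℤ) + m) + (m * m - g) := by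
      ring
    rw [this]
    exact dvd_add (dvd_mul_of_dvd_left e _) h

/-- `p^(2j+1) ∣ m² ⇒ p^(j+1) ∣ m` for a prime `p`. [folklore] -/
theorem pow_succ_dvd_of_odd_pow_dvd_sq {p : ℤ} (hp : Prime p) :
    ∀ (j : ℕ) (m : ℤ), p ^ (2 * j + 1) ∣ m * m → p ^ (j + 1) ∣ m
  | 0, m, h => by
      have h' : p ∣ m * m := by simpa using h
      rcases hp.dvd_or_dvd h' with h1 | h1 <;> simpa using h1
  | j + 1, m, h => by
      have h' : p ∣ m * m := (dvd_pow_self p (by omega)).trans h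
      obtain ⟨m', rfl⟩ : p ∣ m := by rcases hp.dvd_or_dvd h' with h1 | h1 <;> exact h1
      have h2 : p ^ (2 * j + 1) ∣ m' * m' := by
        have e1 : p ^ (2 * (j + 1) + 1) = (p * p) * p ^ (2 * j + 1) := by ring
        rw [e1, show p * m' * (p * m') = (p * p) * (m' * m') by ring] at h
        exact (mul_dvd_mul_iff_left (mul_ne_zero hp.ne_zero hp.ne_zero)).mp h
      have ih := pow_succ_dvd_of_odd_pow_dvd_sq hp j m' h2
      rw [pow_succ, mul_comm p m']
      exact mul_dvd_mul ih dvd_rfl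

/-- `p^(2j) ∣ m² ⇒ p^j ∣ m` for a prime `p`. [folklore] -/
theorem pow_dvd_of_even_pow_dvd_sq {p : ℤ} (hp : Prime p) :
    ∀ (j : ℕ) (m : ℤ), p ^ (2 * j) ∣ m * m → p ^ j ∣ m
  | 0, m, _ => by simp
  | j + 1, m, h => pow_succ_dvd_of_odd_pow_dvd_sq hp j m ((pow_dvd_pow p (by omega)).trans h)

/-- The square of an odd integer is `1 mod 8`. [folklore] -/
theorem eight_dvd_sq_sub_one_of_odd {m : ℤ} (hm : Odd m) : (8 : ℤ) ∣ m * m - 1 := by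
  obtain ⟨t, rfl⟩ := hm
  obtain ⟨s, hs⟩ := Int.even_mul_succ_self t
  exact ⟨s, by linear_combination 4 * hs⟩

/-- **Dead nodes are sound**: no integer `≡ N (mod p^k)` is a square. [folklore] -/
theorem qdead_sound {p : ℕ} (hp : p.Prime) {N : ℤ} {k : ℕ} (hd : qdead p N k = true) {x : ℤ}
    (hx : (p : ℤ) ^ k ∣ x - N) (m : ℤ) : x ≠ m * m := by
  intro hxm
  subst hxm
  have hpZ : Prime (p : ℤ) := Nat.prime_iff_prime_int.mp hp
  obtain ⟨hek, hN, hg⟩ := pval_spec p k N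
  unfold qdead at hd
  generalize pval p k N = r at hek hN hg hd
  obtain ⟨e, g⟩ := r
  dsimp only at hek hN hg hd
  subst hN
  simp only [Bool.and_eq_true, decide_eq_true_eq] at hd
  obtain ⟨helt, hrest⟩ := hd
  have hg' := hg helt
  -- the exponent of `p` in `m²` is exactly `e`
  have h1 : (p : ℤ) ^ e ∣ m * m := by
    have h := (pow_dvd_pow (p : ℤ) hek).trans hx
    simpa using dvd_add h (dvd_mul_right ((p : ℤ) ^ e) g)
  have h2 : ¬ (p : ℤ) ^ (e + 1) ∣ m * m := by
    intro h
    have h' := (pow_dvd_pow (p : ℤ) (by omega : e + 1 ≤ k)).trans hx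
    have hN' : (p : ℤ) ^ (e + 1) ∣ (p : ℤ) ^ e * g := by simpa using dvd_sub h h'
    rw [pow_succ] at hN'
    exact hg' ((mul_dvd_mul_iff_left (pow_ne_zero _ hpZ.ne_zero)).mp hN')
  by_cases hodd : e % 2 = 1
  · -- odd exponent: impossible for a square
    obtain ⟨j, hj⟩ : ∃ j, e = 2 * j + 1 := ⟨e / 2, by omega⟩
    have hm := pow_succ_dvd_of_odd_pow_dvd_sq hpZ j m (by rw [← hj]; exact h1)
    apply h2
    rw [hj, show 2 * j + 1 + 1 = (j + 1) + (j + 1) by ring, pow_add]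
    exact mul_dvd_mul hm hm
  · -- even exponent `2j`: `m = p^j m₁`, `p ∤ m₁`, `m₁² ≡ g (mod p^(k-2j))`
    obtain ⟨j, hj⟩ : ∃ j, e = 2 * j := ⟨e / 2, by omega⟩
    obtain ⟨m₁, hm₁⟩ := pow_dvd_of_even_pow_dvd_sq hpZ j m (by rw [← hj]; exact h1)
    have hm₁p : ¬ (p : ℤ) ∣ m₁ := by
      intro hd1
      apply h2
      rw [hm₁, hj]
      have h3 : (p : ℤ) ^ (2 * j + 1) ∣ (p : ℤ) ^ j * (p : ℤ) ^ j * (p : ℤ) := by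
        rw [← pow_add, ← pow_succ]; exact pow_dvd_pow _ (by omega)
      refine h3.trans ?_
      rw [show (p : ℤ) ^ j * m₁ * ((p : ℤ) ^ j * m₁) = (p : ℤ) ^ j * (p : ℤ) ^ j * (m₁ * m₁) by ring]
      exact mul_dvd_mul_left _ (dvd_mul_of_dvd_left hd1 _)
    have hke : k = 2 * j + (k - 2 * j) := by omega
    have hdiff : (p : ℤ) ^ (k - 2 * j) ∣ m₁ * m₁ - g := by
      have h := hx
      rw [hm₁, hj, hke, pow_add,
        show (p : ℤ) ^ j * m₁ * ((p : ℤ) ^ j * m₁) - (p : ℤ) ^ (2 * j) * g =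
          (p : ℤ) ^ (2 * j) * (m₁ * m₁ - g) by ring] at h
      exact (mul_dvd_mul_iff_left (pow_ne_zero _ hpZ.ne_zero)).mp h
    by_cases hp2 : p = 2
    · subst hp2
      simp only [↓reduceIte, Bool.or_eq_true, Bool.and_eq_true, decide_eq_true_eq] at hrest
      have hm₁odd : Odd m₁ :=
        Int.not_even_iff_odd.mp (by rw [even_iff_two_dvd]; exact_mod_cast hm₁p)
      have h8 := eight_dvd_sq_sub_one_of_odd hm₁odd
      rcases hrest with hbad | ⟨hk2, hg4⟩ | ⟨hk3, hg8⟩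
      · exact hodd hbad
      · have h4 : (4 : ℤ) ∣ m₁ * m₁ - g := by
          have h22 : ((2 : ℕ) : ℤ) ^ (k - 2 * j) = 4 * 2 ^ (k - 2 * j - 2) := by
            rw [show k - 2 * j = 2 + (k - 2 * j - 2) by omega, pow_add]; norm_num
          rw [h22] at hdiff
          exact (Dvd.intro _ rfl).trans hdiff
        have h4' : (4 : ℤ) ∣ m₁ * m₁ - 1 := (by norm_num : (4 : ℤ) ∣ 8).trans h8
        obtain ⟨q₁, hq₁⟩ := h4
        obtain ⟨q₂, hq₂⟩ := h4'
        generalize m₁ * m₁ = y at hq₁ hq₂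
        omega
      · have h8' : (8 : ℤ) ∣ m₁ * m₁ - g := by
          have h23 : ((2 : ℕ) : ℤ) ^ (k - 2 * j) = 8 * 2 ^ (k - 2 * j - 3) := by
            rw [show k - 2 * j = 3 + (k - 2 * j - 3) by omega, pow_add]; norm_num
          rw [h23] at hdiff
          exact (Dvd.intro _ rfl).trans hdiff
        obtain ⟨q₁, hq₁⟩ := h8
        obtain ⟨q₂, hq₂⟩ := h8'
        generalize m₁ * m₁ = y at hq₁ hq₂
        omega
    · simp only [hp2, ↓reduceIte, Bool.or_eq_true, decide_eq_true_eq, Bool.not_eq_true'] at hrest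
      rcases hrest with hbad | hrest
      · exact hodd hbad
      have hp1 : (p : ℤ) ∣ m₁ * m₁ - g :=
        (dvd_pow_self (p : ℤ) (by omega : k - 2 * j ≠ 0)).trans hdiff
      have := sqResidue_of_sq hp.pos hp1
      rw [hrest] at this
      exact Bool.false_ne_true this

/-- Congruent pairs have congruent `quartEval`-values. [folklore] -/
theorem quartEval_congr (g : ℤ × ℤ × ℤ × ℤ × ℤ) (M : ℕ) {u u' v v' : ℤ}
    (hu : (M : ℤ) ∣ u - u') (hv : (M : ℤ) ∣ v - v') :
    (M : ℤ) ∣ quartEval g u v - quartEval g u' v' := by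
  have eu := (ZMod.intCast_eq_intCast_iff_dvd_sub u' u M).mpr hu
  have ev := (ZMod.intCast_eq_intCast_iff_dvd_sub v' v M).mpr hv
  have h1 := map_quartEval (Int.castRingHom (ZMod M)) g u v
  have h2 := map_quartEval (Int.castRingHom (ZMod M)) g u' v'
  simp only [eq_intCast] at h1 h2
  rw [eu, ev, ← h1] at h2
  exact (ZMod.intCast_eq_intCast_iff_dvd_sub _ _ M).mp h2

/-- **Node soundness**: if `qnode p g A f w k = true` then no pair `(u, v)` congruent to the node
(`(w, 1)` in chart A, `(1, w)` in chart B; the scaled coordinate to precision `p^(k+f)`) has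
`G(u, v)` a square. [cite: CremonaAlgorithms1997, §3.6] -/
theorem qnode_sound {p : ℕ} (hp : p.Prime) (g : ℤ × ℤ × ℤ × ℤ × ℤ) (A : Bool) :
    ∀ (f : ℕ) (w : ℤ) (k : ℕ), qnode p g A f w k = true → ∀ u v : ℤ,
      (A = true → ((p ^ k : ℕ) : ℤ) ∣ u - w ∧ ((p ^ (k + f) : ℕ) : ℤ) ∣ v - 1) →
      (A = false → ((p ^ (k + f) : ℕ) : ℤ) ∣ u - 1 ∧ ((p ^ k : ℕ) : ℤ) ∣ v - w) →
      ∀ m : ℤ, quartEval g u v ≠ m * m := by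
  intro f
  induction f with
  | zero =>
      intro w k h u v hA hB m
      simp only [qnode] at h
      have hc : ((p ^ k : ℕ) : ℤ) ∣ quartEval g u v - qval g A w := by
        cases A
        · obtain ⟨hu, hv⟩ := hB rfl
          simpa [qval] using quartEval_congr g (p ^ k) (by simpa using hu) hv
        · obtain ⟨hu, hv⟩ := hA rfl
          simpa [qval] using quartEval_congr g (p ^ k) hu (by simpa using hv)
      exact qdead_sound hp h (by simpa using hc) m
  | succ f ih =>
      intro w k h u v hA hB m
      simp only [qnode, Bool.or_eq_true, List.all_eq_true, List.mem_range] at h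
      have hpk : ((p ^ k : ℕ) : ℤ) ∣ ((p ^ (k + (f + 1)) : ℕ) : ℤ) :=
        Int.natCast_dvd_natCast.mpr (pow_dvd_pow p (by omega))
      rcases h with hd | hall
      · have hc : ((p ^ k : ℕ) : ℤ) ∣ quartEval g u v - qval g A w := by
          cases A
          · obtain ⟨hu, hv⟩ := hB rfl
            simpa [qval] using quartEval_congr g (p ^ k) (hpk.trans hu) hv
          · obtain ⟨hu, hv⟩ := hA rfl
            simpa [qval] using quartEval_congr g (p ^ k) hu (hpk.trans hv)
        exact qdead_sound hp hd (by simpa using hc) m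
      · have hkf : k + 1 + f = k + (f + 1) := by ring
        cases A
        · obtain ⟨hu, hv⟩ := hB rfl
          obtain ⟨d, hd, e⟩ := exists_digit hp.pos (p ^ k) hv
          have e' : ((p ^ (k + 1) : ℕ) : ℤ) ∣ v - (w + (p : ℤ) ^ k * (d : ℤ)) := by
            push_cast at e ⊢; rw [pow_succ]; exact e
          exact ih (w + (p : ℤ) ^ k * (d : ℤ)) (k + 1) (hall d hd) u v (fun h => by simp at h)
            (fun _ => ⟨by rw [hkf]; exact hu, e'⟩) m
        · obtain ⟨hu, hv⟩ := hA rfl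
          obtain ⟨d, hd, e⟩ := exists_digit hp.pos (p ^ k) hu
          have e' : ((p ^ (k + 1) : ℕ) : ℤ) ∣ u - (w + (p : ℤ) ^ k * (d : ℤ)) := by
            push_cast at e ⊢; rw [pow_succ]; exact e
          exact ih (w + (p : ℤ) ^ k * (d : ℤ)) (k + 1) (hall d hd) u v
            (fun _ => ⟨e', by rw [hkf]; exact hv⟩) (fun h => by simp at h) m

/-- **Soundness of the QK certificate**: if `qkCheck p g fuel = true` for a prime `p`, then
`G(u, v)` is not a square for any integers `u, v` not both divisible by `p`.
[cite: CremonaAlgorithms1997, §3.6] -/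
theorem qkCheck_sound {p : ℕ} (hp : p.Prime) {g : ℤ × ℤ × ℤ × ℤ × ℤ} {fuel : ℕ}
    (h : qkCheck p g fuel = true) (u v m : ℤ) (hprim : ¬ ((p : ℤ) ∣ u ∧ (p : ℤ) ∣ v))
    (he : quartEval g u v = m * m) : False := by
  have hp0 : 0 < p := hp.pos
  have hpZ : Prime (p : ℤ) := Nat.prime_iff_prime_int.mp hp
  simp only [qkCheck, Bool.and_eq_true, List.all_eq_true, List.mem_range] at h
  obtain ⟨hcA, hcB⟩ := h
  have unit_of : ∀ w : ℤ, ¬ (p : ℤ) ∣ w → ∃ l t : ℤ, l * w + t * (p : ℤ) ^ (1 + fuel) = 1 := by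
    intro w hw
    have hcop : IsCoprime w ((p : ℤ) ^ (1 + fuel)) :=
      ((Prime.coprime_iff_not_dvd hpZ).mpr hw).symm.pow_right
    obtain ⟨l, t, hlt⟩ := hcop
    exact ⟨l, t, hlt⟩
  have digit : ∀ w : ℤ, ∃ d : ℕ, d < p ∧ (p : ℤ) ∣ w - d := by
    intro w
    have hp' : (0 : ℤ) < p := by exact_mod_cast hp0
    refine ⟨(w % (p : ℤ)).toNat, ?_, w / p, ?_⟩
    · have := Int.emod_lt_of_pos w hp'; have := Int.emod_nonneg w hp'.ne'; omega
    · rw [Int.toNat_of_nonneg (Int.emod_nonneg w hp'.ne')]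
      linear_combination (-1 : ℤ) * Int.emod_add_ediv_mul w (p : ℤ)
  -- the scaled pair `(l u, l v)` has `G = (l² m)²`
  have scaled : ∀ l : ℤ, quartEval g (l * u) (l * v) = (l ^ 2 * m) * (l ^ 2 * m) := by
    intro l; rw [quartEval_smul, he]; ring
  by_cases hv : (p : ℤ) ∣ v
  · -- chart B: `p ∣ v`, so `p ∤ u`; scale `u` to `1`
    have hu : ¬ (p : ℤ) ∣ u := fun hu => hprim ⟨hu, hv⟩
    obtain ⟨l, t, hlt⟩ := unit_of u hu
    refine qnode_sound hp g false fuel 0 1 hcB (l * u) (l * v) (fun h => by simp at h)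
      (fun _ => ⟨⟨-t, ?_⟩, ?_⟩) (l ^ 2 * m) (scaled l)
    · push_cast; linear_combination hlt
    · simpa using dvd_mul_of_dvd_right hv l
  · -- chart A: scale `v` to `1`, first digit of `l u`
    obtain ⟨l, t, hlt⟩ := unit_of v hv
    obtain ⟨d, hd, e⟩ := digit (l * u)
    refine qnode_sound hp g true fuel (d : ℤ) 1 (hcA d hd) (l * u) (l * v)
      (fun _ => ⟨by simpa using e, ⟨-t, ?_⟩⟩) (fun h => by simp at h) (l ^ 2 * m) (scaled l)
    push_cast; linear_combination hlt

end Summit.BirchSwinnertonDyer.BirchSwinnertonDyer.Rank2Observatory.TwoDescKill
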